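import Literature.AnabelianGeometry.SemiGraphs.TemperedAnchoredCompactOfAbelianEdges
import Literature.AnabelianGeometry.SemiGraphs.TemperedEdgeLikeDistinctProofs
import Literature.AnabelianGeometry.SemiGraphs.TemperedVerticialNamedFactsProofs
import Literature.AnabelianGeometry.SemiGraphs.TemperedPiRayApartment
import Literature.AnabelianGeometry.SemiGraphs.TemperedMaximalCompactOfProP
import Literature.GroupTheory.CompactGroupIntersections
import HarnessLib

/-!
# [SemiAnbd] Thm 3.7 (iv), the half «verticial ⇒ maximal compact», at a vertex of FINITE VALENCE —
# arbitrary edge groups, arbitrary underlying graph (proof-only) — and the union with the Frattini class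

Mochizuki, *Semi-graphs of anabelioids*, Publ. RIMS **42** (2006), §3, Theorem 3.7 (iv) p. 41 ("the maximal
compact subgroups of `π₁^temp(𝒢)` are precisely the verticial subgroups of `π₁^temp(𝒢)`"), with Def. 2.4 (i)
p. 25 (totally elevated: the branch subgroups `Π_b ⊊ Π_v`) [cite: MochizukiSemiAnbd2006, Thm 3.7(iv) p.41].

PROOF-ONLY file (abc-iut cell, layer L3, seat abc-iut-w6-d064 gen 8, row «T37iv-VERT⇒MAXCPT@FRATTINI»; no
definition, no named fact).  The half «every verticial subgroup of `π₁^temp(𝒢)` is a MAXIMAL compact subgroup»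
of the first sentence of Thm. 3.7 (iv) is in the tree for locally finite graphs (abc-iut-w6-d062, abc-iut-w6-d063), for
graphs with TOPOLOGICALLY CYCLIC edge groups (this seat, gen 7), under the one-level criteria NOFIX /
stabiliser-level (abc-iut-L3-t6 gen 9) and — the «Frattini» VERTEX class — at every vertex whose group has an
OPEN subgroup NON-GENERATING for closed subgroups, e.g. a topologically finitely generated pro-`p` group
(abc-iut-L3-t6 gen 10, `TemperedPiChart.isMaximalCompactSubgroup_of_nongenerating_open` / `…_of_proP`,
`TemperedMaximalCompactOfProP.lean` — CITED BY NAME below, not restated).  This file adds the complementary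
VERTEX class with NO hypothesis on the groups, and the union of the two:

* `isMaximalCompactSubgroup_of_mem_verticialSubgroups_of_finite_branches` — **at a vertex `v` of FINITE VALENCE
  (finitely many branches abut to `v`) every verticial subgroup at `v` is a maximal compact subgroup** — every
  countable `𝒢` under the hypotheses of Thm. 3.7, ARBITRARY vertex / edge groups, ARBITRARY valence elsewhere,
  every chart; the engine `exists_level_forall_branchSubgroup_mul_ker_of_range_decompHom_lt` holds at any vertex;
* `isMaximalCompactSubgroup_of_mem_verticialSubgroups_of_finite_branches_or_nongenerating` and
  `…_of_forall_finite_branches_or_nongenerating` — **the UNION class**: at a vertex of finite valence OR whose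
  group has an open non-generating subgroup (abc-iut-L3-t6's theorem, by name), resp. at every vertex of a graph
  all of whose vertices are of one of the two kinds (e.g. the rayless star `𝒢⋆(p)`: leaves of valence `1`,
  centre `F̂₂` pro-`p`), every verticial subgroup is maximal compact;
(At locally finite graphs the first theorem IS abc-iut-w6-d062's `…_of_isLocallyFinite`, via abc-iut-f-172's
`finite_branches_of_isLocallyFinite` — not restated.)

THE ARGUMENT (canonical chart `π₁^temp(𝒢) = lim_n Aut(𝒢_{∞,n})`, transported to any chart at the end).  A
verticial subgroup is the image `H = δ_P(Π_v)` of the decomposition homomorphism of a compatible point sequence `P`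
over `v` (abc-iut-L3-t6/t8); it fixes the vertices `P_n` of the trees `𝔾̃_n`.  Let `K ⊋ H` be compact.  An element
of `π₁^temp` fixing every `P_n` lies in `H` (abc-iut-L3-t6's `mem_range_decompHom_of_fixes`), so some `g₀ ∈ K`
moves `P_{n₀}`, hence moves `P_m` for all `m ≥ n₀`.  At such a level `m`, the compact `K` fixes SOME vertex `z`
([SemiAnbd] Lemma 1.8 (ii), `SemiGraph.exists_fixed_vertex_of_isCompact_over`), `z ≠ P_m`, and `H ≤ K` fixes both,
hence fixes the first branch `β` of the geodesic `[P_m, z]` — a branch AT `P_m` over a branch `b` of `𝔾` AT `v`.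
By the one-level branch-stabiliser dictionary (abc-iut-L3-t11 / this seat's
`PointSeq.exists_conj_forall_gal_brHom_of_branchMap_eq`) the level-`m` components `σ_m^h`, `h ∈ Π_v`, all lie in
`σ_m^{f · Π_b · f⁻¹}` for ONE `f ∈ Π_v`; as `h ↦ σ_m^h` is a homomorphism this says `Π_v = Π_b · N_m` where
`N_m = {k | σ_m^k = 1}` is the (closed, decreasing) level-`m` kernel (the same supplement identity as abc-iut-L3-t6's
stabiliser-level lemma `exists_conj_forall_stabilizes_of_forall_edgeMap_eq`, p497081, here at EVERY large level),
and `⋂_m N_m = 1` by Thm. 3.7 (i) (injectivity of `δ_P`, `verticialInjective_holds`).  With finitely many branches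
at `v` one branch `b` serves cofinally many levels, so `Π_v = Π_b · N_m` for ALL `m`, and by compactness of `Π_v`
the closed `Π_b` is all of `Π_v` — against TOTAL ELEVATION (`branchSubgroup_ne_top`, abc-iut-L3: `Π_b ≠ Π_v`).

Honest framing: OUR typed `π₁^temp`; the other half of the first sentence of Thm. 3.7 (iv) («maximal compact ⇒
verticial») is NOT touched here — it fails as typed at `𝒢_θ` and `𝒢⋆(p)` (abc-iut-w4-d011 p443103, abc-iut-L3-t8);
class theorems at OUR typing ≠ print's ∀-claims about finite `𝔾`; nothing here bears on [IUTchIII] Cor. 3.12;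
typed ≠ proved.
-/

namespace Literature.AnabelianGeometry.SemiGraphs

namespace ProfiniteSemiGraph

open CategoryTheory Topology
open Literature.GroupTheory.CompactGroupIntersections (exists_mem_forall_of_antitone)

universe u

variable (𝒢 : ProfiniteSemiGraph.{u})

/-! ### The engine: a compact proper over-group of `δ_P(Π_v)` forces `Π_v = Π_b · N_m` at every large level -/

/-- **Core lemma** (canonical chart).  Let `P` be a compatible point sequence over `v` and `K` a compact subgroup of
`π₁^temp(𝒢)` containing the decomposition image `δ_P(Π_v)` PROPERLY.  Then from some level `n₀` on, at every
level `m ≥ n₀` there is a branch `b` of `𝔾` abutting to `v` such that `Π_v = Π_b · N_m`, `N_m = ker (h ↦ σ_m^h)`: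
every `h ∈ Π_v` is `a · k` with `a ∈ Π_b` and `σ_m^k = 1`. [cite: MochizukiSemiAnbd2006, Thm 3.7(iv) p.41] -/
theorem exists_level_forall_branchSubgroup_mul_ker_of_range_decompHom_lt (h36 : 𝒢.Prop36Hypotheses)
    {v : 𝒢.graph.Vertex} (P : (𝒢.galoisLevelData h36).PointSeq h36.isCountable v)
    (K : Subgroup (𝒢.temperedPiChart h36).G) (hKc : IsCompact (K : Set (𝒢.temperedPiChart h36).G))
    (hPK : P.decompHom.range ≤ K) (hne : P.decompHom.range ≠ K) :
    ∃ n₀ : ℕ, ∀ m, n₀ ≤ m → ∃ (b : 𝒢.graph.Branch) (hb : 𝒢.graph.abuts b = some v),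
      ∀ h : 𝒢.Gv v, ∃ a ∈ 𝒢.branchSubgroup b v hb, P.gal m (a⁻¹ * h) = 1 := by
  classical
  let D₀ : VerticialLevelData.{0} 𝒢 (𝒢.temperedPiChart h36) := verticialLevelData_temperedPiChart (h36 := h36)
  -- some `g₀ ∈ K` outside the decomposition image, hence moving some `P_{n₀}`
  obtain ⟨g₀, hg₀K, hg₀⟩ : ∃ g₀ ∈ K, g₀ ∉ P.decompHom.range := by
    by_contra hcon
    push Not at hcon
    exact hne (le_antisymm hPK hcon)
  have hmove : ∃ n₀, ((𝒢.galoisLevelData h36).treeAct h36.isCountable n₀ g₀).hom.vertexMap (P.vertex n₀) ≠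
      P.vertex n₀ := by
    by_contra hcon
    push Not at hcon
    exact hg₀ (P.mem_range_decompHom_of_fixes g₀ hcon)
  obtain ⟨n₀, hn₀⟩ := hmove
  refine ⟨n₀, fun m hm => ?_⟩
  -- `g₀` moves `P_m` as well (the transition map `𝔾̃_m → 𝔾̃_{n₀}` is equivariant and maps `P_m ↦ P_{n₀}`)
  have hg₀m : (D₀.act m g₀).hom.vertexMap (P.vertex m) ≠ P.vertex m := by
    intro heq
    apply hn₀
    have h1 := D₀.trans_act_vertexMap hm g₀ (P.vertex m)
    rw [heq] at h1
    change ((𝒢.galoisLevelData h36).treeTrans hm).vertexMap (P.vertex m) =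
      ((𝒢.galoisLevelData h36).treeAct h36.isCountable n₀ g₀).hom.vertexMap
        (((𝒢.galoisLevelData h36).treeTrans hm).vertexMap (P.vertex m)) at h1
    rw [P.treeTrans_vertex hm] at h1
    exact h1.symm
  -- the compact `K` fixes a vertex `z` of `𝔾̃_m`
  obtain ⟨z, hz⟩ := SemiGraph.exists_fixed_vertex_of_isCompact_over K hKc (D₀.isTree m) (D₀.vertex m)
    (D₀.proj m) (D₀.act m) (D₀.isOpen_ker m) (D₀.act_over m)
  have hzK : ∀ g ∈ K, (D₀.act m g).hom.vertexMap z = z := fun g hg => hz ⟨g, hg⟩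
  have hzne : P.vertex m ≠ z := by
    intro heq
    exact hg₀m (heq ▸ hzK g₀ hg₀K)
  -- `H = δ_P(Π_v)` fixes `P_m` and `z`
  have hHfixP : ∀ g ∈ P.decompHom.range, (D₀.act m g).hom.vertexMap (P.vertex m) = P.vertex m := by
    rintro g ⟨h, rfl⟩
    exact P.treeAct_decompHom_vertexMap m h
  have hHfixz : ∀ g ∈ P.decompHom.range, (D₀.act m g).hom.vertexMap z = z :=
    fun g hg => hzK g (hPK hg)
  -- hence a branch `β` AT `P_m` fixed by `H`
  obtain ⟨β, hβ, hβfix⟩ := D₀.exists_fixed_branch_of_two_fixed_vertices P.decompHom.range m hzne hHfixP hHfixz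
  -- its image `b` is a branch of `𝔾` at `v`
  have hb : 𝒢.graph.abuts (((𝒢.galoisLevelData h36).treeProj m).branchMap β) = some v := by
    have h1 := ((𝒢.galoisLevelData h36).treeProj m).abuts_branchMap β (P.vertex m) hβ
    rw [P.treeProj_vertexMap_vertex m] at h1
    exact h1
  refine ⟨((𝒢.galoisLevelData h36).treeProj m).branchMap β, hb, ?_⟩
  -- one conjugator for the branch: `σ_m^g ∈ σ_m^{f Π_b f⁻¹}` for the component of every `g` fixing `β`
  obtain ⟨f, hf⟩ := P.exists_conj_forall_gal_brHom_of_branchMap_eq m _ hb β rfl hβ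
  intro h
  -- apply the dictionary to `δ_P(f h f⁻¹)`, whose level-`m` component is `σ_m^{f h f⁻¹}`
  obtain ⟨k, hk⟩ := hf (P.decompHom (f * h * f⁻¹)) (hβfix _ ⟨f * h * f⁻¹, rfl⟩)
  rw [P.proj_decompHom] at hk
  have hmul : ∀ x y : 𝒢.Gv v, P.gal m (x * y) = P.gal m x * P.gal m y := fun x y => P.gal_mul m x y
  simp only [hmul] at hk
  -- cancel `σ_m^f` on both sides: `σ_m^h = σ_m^{b_*(k)}`
  have hk' : P.gal m h = P.gal m (𝒢.brHom _ v hb k) := mul_left_cancel (mul_right_cancel hk)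
  refine ⟨𝒢.brHom _ v hb k, ⟨k, rfl⟩, ?_⟩
  rw [hmul, hk', ← hmul, inv_mul_cancel, P.gal_one]

/-! ### The level kernels `N_m = {k ∈ Π_v | σ_m^k = 1}`: decreasing, with trivial intersection (Thm 3.7 (i)) -/

/-- The level kernels decrease: `σ_j^k = 1 ⇒ σ_i^k = 1` for `i ≤ j` (`σ_i^k` is the image of `σ_j^k`).
[cite: MochizukiSemiAnbd2006, Prop 3.6 p.38] -/
theorem pointSeq_gal_eq_one_of_le (h36 : 𝒢.Prop36Hypotheses) {v : 𝒢.graph.Vertex}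
    (P : (𝒢.galoisLevelData h36).PointSeq h36.isCountable v) {i j : ℕ} (hij : i ≤ j) (k : 𝒢.Gv v)
    (hk : P.gal j k = 1) : P.gal i k = 1 := by
  rw [← (𝒢.galoisLevelData h36).mapLE_of_step h36.isCountable (fun n => P.gal n k) (fun n => P.step_gal n k) hij,
    hk, map_one]

/-- **`⋂_m N_m = 1`**: an element of `Π_v` all of whose level components `σ_m^k` are trivial is trivial — the
decomposition homomorphism `δ_P` is injective (Thm 3.7 (i), `verticialInjective_holds`, for the verticial
`δ_P`, abc-iut-L3-t8's `isVerticialHom_decompHomCont`). [cite: MochizukiSemiAnbd2006, Thm 3.7(i) p.40] -/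
theorem pointSeq_eq_one_of_forall_gal_eq_one (h37 : 𝒢.Thm37Hypotheses) {v : 𝒢.graph.Vertex}
    (P : (𝒢.galoisLevelData h37.toProp36Hypotheses).PointSeq h37.isCountable v) (k : 𝒢.Gv v)
    (hk : ∀ n, P.gal n k = 1) : k = 1 := by
  have hinj := (verticialInjective_holds 𝒢 h37 (𝒢.temperedPiChart h37.toProp36Hypotheses) v).2
    P.decompHomCont P.isVerticialHom_decompHomCont
  apply hinj
  rw [map_one]
  change P.decompHom k = 1
  exact (𝒢.galoisLevelData h37.toProp36Hypotheses).pi_ext h37.isCountable fun n => by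
    rw [P.proj_decompHom, hk n, map_one]

/-- Branch subgroups are closed (continuous images of compact groups in the Hausdorff `Π_v`).
[cite: MochizukiSemiAnbd2006, §2 p.23] -/
theorem isClosed_branchSubgroup {v : 𝒢.graph.Vertex} (b : 𝒢.graph.Branch) (hb : 𝒢.graph.abuts b = some v) :
    IsClosed (𝒢.branchSubgroup b v hb : Set (𝒢.Gv v)) := by
  haveI : T2Space (𝒢.Gv v) := IsTopologicalGroup.t2Space_of_one_sep fun x hx =>
    ⟨{x}ᶜ, isOpen_compl_singleton.mem_nhds (by simpa using hx.symm), fun h => h rfl⟩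
  change IsClosed (Set.range (𝒢.brHom b v hb).toMonoidHom)
  exact (isCompact_range (𝒢.brHom b v hb).continuous).isClosed

/-! ### Finite valence: `δ_P(Π_v)` is a maximal compact subgroup -/

/-- **At the canonical chart: `δ_P(Π_v)` is a maximal compact subgroup whenever `v` has FINITELY MANY branches**
(no hypothesis on the groups).  For a compact `K ⊋ δ_P(Π_v)` the core lemma gives branches `b_m` at `v` with
`Π_v = Π_{b_m} · N_m`; one branch `b` serves infinitely many levels, so `Π_v = Π_b · N_m` for all `m`, and since the
`N_m` decrease to `1` the closed `Π_b` is all of `Π_v` — against total elevation. [cite: MochizukiSemiAnbd2006, Thm 3.7(iv) p.41] -/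
theorem isMaximalCompactSubgroup_range_decompHom_of_finite_branches (h37 : 𝒢.Thm37Hypotheses)
    {v : 𝒢.graph.Vertex} (P : (𝒢.galoisLevelData h37.toProp36Hypotheses).PointSeq h37.isCountable v)
    (hfin : Set.Finite {b : 𝒢.graph.Branch | 𝒢.graph.abuts b = some v}) :
    IsMaximalCompactSubgroup P.decompHom.range := by
  classical
  refine ⟨?_, fun K hKc hPK => ?_⟩
  · rw [MonoidHom.coe_range]
    exact isCompact_range P.continuous_decompHom
  · by_contra hne
    obtain ⟨n₀, hn₀⟩ := 𝒢.exists_level_forall_branchSubgroup_mul_ker_of_range_decompHom_lt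
      h37.toProp36Hypotheses P K hKc hPK (Ne.symm hne)
    choose bOf hbOf hprod using fun m : ℕ => hn₀ (max m n₀) (le_max_right m n₀)
    -- one branch serves infinitely many levels
    haveI : Finite {b : 𝒢.graph.Branch | 𝒢.graph.abuts b = some v} := hfin.to_subtype
    let F : ℕ → {b : 𝒢.graph.Branch | 𝒢.graph.abuts b = some v} := fun m => ⟨bOf m, hbOf m⟩
    obtain ⟨⟨b, hb⟩, hinf⟩ := Finite.exists_infinite_fiber F
    have hfib : (F ⁻¹' {⟨b, hb⟩}).Infinite := Set.infinite_coe_iff.mp hinf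
    -- `Π_v = Π_b · N_i` at EVERY level `i`
    have hall : ∀ (i : ℕ) (x : 𝒢.Gv v), ∃ a ∈ 𝒢.branchSubgroup b v hb, P.gal i (a⁻¹ * x) = 1 := by
      intro i x
      obtain ⟨m, hm, him⟩ := hfib.exists_gt i
      have hbm : bOf m = b := congrArg Subtype.val (show F m = ⟨b, hb⟩ from hm)
      obtain ⟨a, ha, h1⟩ := hprod m x
      refine ⟨a, ?_, 𝒢.pointSeq_gal_eq_one_of_le h37.toProp36Hypotheses P
        ((le_of_lt him).trans (le_max_left m n₀)) _ h1⟩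
      -- transport the membership along `bOf m = b` (the proof of abutment is irrelevant)
      obtain ⟨k, rfl⟩ := ha
      subst hbm
      exact ⟨k, rfl⟩
    -- hence the closed `Π_b` is everything: for each `x`, one `a ∈ Π_b` with `σ_i^{a⁻¹ x} = 1` for all `i`
    refine 𝒢.branchSubgroup_ne_top h37.isTotallyElevated hb ?_
    rw [eq_top_iff]
    intro x _
    obtain ⟨a, ha⟩ := exists_mem_forall_of_antitone
      (fun i : ℕ => (𝒢.branchSubgroup b v hb : Set (𝒢.Gv v)) ∩ {a : 𝒢.Gv v | P.gal i (a⁻¹ * x) = 1})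
      (fun i j hij a hax => ⟨hax.1, 𝒢.pointSeq_gal_eq_one_of_le h37.toProp36Hypotheses P hij _ hax.2⟩)
      (fun i => by
        obtain ⟨a, ha, h1⟩ := hall i x
        exact ⟨a, ha, h1⟩)
      (fun i => by
        have hc : IsClosed ((fun a : 𝒢.Gv v => a⁻¹ * x) ⁻¹' {y : 𝒢.Gv v | P.gal i y = 1}) :=
          (P.isClosed_setOf_gal_eq i 1).preimage (continuous_inv.mul continuous_const)
        exact (𝒢.isClosed_branchSubgroup b hb).inter hc)
    have h1 : a⁻¹ * x = 1 := 𝒢.pointSeq_eq_one_of_forall_gal_eq_one h37 P _ fun n => (ha n).2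
    have hax : x = a := by
      rw [← mul_left_cancel_iff (a := a⁻¹), h1, inv_mul_cancel]
    rw [hax]
    exact (ha 0).1

/-! ### Verticial subgroups: canonical chart, then every chart -/

/-- Canonical chart: a verticial subgroup at a vertex with finitely many branches is maximal compact.
[cite: MochizukiSemiAnbd2006, Thm 3.7(iv) p.41] -/
theorem isMaximalCompactSubgroup_of_mem_verticialSubgroups_of_finite_branches_canonical
    (h37 : 𝒢.Thm37Hypotheses) {v : 𝒢.graph.Vertex}
    (hfin : Set.Finite {b : 𝒢.graph.Branch | 𝒢.graph.abuts b = some v})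
    {H : Subgroup (𝒢.temperedPiChart h37.toProp36Hypotheses).G}
    (hH : H ∈ verticialSubgroups (𝒢.temperedPiChart h37.toProp36Hypotheses) v) :
    IsMaximalCompactSubgroup H := by
  obtain ⟨ψ, hψ, rfl⟩ := hH
  obtain ⟨P, hP⟩ := exists_pointSeq_of_isVerticialHom (h36 := h37.toProp36Hypotheses) (v := v) (ψ := ψ) hψ
  rw [← hP]
  exact 𝒢.isMaximalCompactSubgroup_range_decompHom_of_finite_branches h37 P hfin

variable {𝒢}

/-- Transport of «verticial ⇒ maximal compact» from the canonical chart to any chart (charts are compatibly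
isomorphic, `TemperedPiChart.exists_compatIso`; verticial subgroups correspond, `mem_verticialSubgroups_iff_map`).
[cite: MochizukiSemiAnbd2006, Thm 3.7(iv) p.41] -/
theorem isMaximalCompactSubgroup_of_mem_verticialSubgroups_of_canonical (h37 : 𝒢.Thm37Hypotheses)
    {v : 𝒢.graph.Vertex}
    (hcan : ∀ H : Subgroup (𝒢.temperedPiChart h37.toProp36Hypotheses).G,
      H ∈ verticialSubgroups (𝒢.temperedPiChart h37.toProp36Hypotheses) v → IsMaximalCompactSubgroup H)
    (c : TemperedPiChart 𝒢) {H : Subgroup c.G} (hH : H ∈ verticialSubgroups c v) :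
    IsMaximalCompactSubgroup H := by
  obtain ⟨φ, ψ, hψφ, hφψ, hφ, hψ⟩ :=
    TemperedPiChart.exists_compatIso (𝒢.temperedPiChart h37.toProp36Hypotheses) c
  have hinj : Function.Injective ψ := fun y₁ y₂ h => by rw [← hφψ y₁, ← hφψ y₂, h]
  have hH' : H.map ψ.toMonoidHom ∈ verticialSubgroups (𝒢.temperedPiChart h37.toProp36Hypotheses) v :=
    (mem_verticialSubgroups_iff_map φ hφ ψ hφψ hψ H).mp hH
  refine ⟨isCompact_of_mem_verticialSubgroups c hH, fun K hKc hHK => ?_⟩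
  have hK' : IsCompact (K.map ψ.toMonoidHom : Set (𝒢.temperedPiChart h37.toProp36Hypotheses).G) := by
    rw [Subgroup.coe_map]
    exact hKc.image ψ.continuous
  have heq : K.map ψ.toMonoidHom = H.map ψ.toMonoidHom :=
    (hcan _ hH').2 _ hK' (Subgroup.map_mono hHK)
  exact Subgroup.map_injective hinj heq

/-- **[SemiAnbd] Thm 3.7 (iv), «verticial ⇒ maximal compact», at a vertex of FINITE VALENCE — arbitrary edge
groups, arbitrary underlying graph, every chart**: for every countable `𝒢` satisfying the hypotheses of Thm 3.7 and
every vertex `v` with finitely many branches, every verticial subgroup of `π₁^temp(𝒢)` at `v` is a maximal compact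
subgroup. [cite: MochizukiSemiAnbd2006, Thm 3.7(iv) p.41] -/
theorem isMaximalCompactSubgroup_of_mem_verticialSubgroups_of_finite_branches (h37 : 𝒢.Thm37Hypotheses)
    {v : 𝒢.graph.Vertex} (hfin : Set.Finite {b : 𝒢.graph.Branch | 𝒢.graph.abuts b = some v})
    (c : TemperedPiChart 𝒢) {H : Subgroup c.G} (hH : H ∈ verticialSubgroups c v) :
    IsMaximalCompactSubgroup H :=
  isMaximalCompactSubgroup_of_mem_verticialSubgroups_of_canonical h37
    (fun _ hH' => 𝒢.isMaximalCompactSubgroup_of_mem_verticialSubgroups_of_finite_branches_canonical h37 hfin hH')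
    c hH

/-! ### The union with the Frattini class of abc-iut-L3-t6 -/

/-- **The UNION class at one vertex**: if `v` has finitely many branches OR `Π_v` has an open subgroup
non-generating for closed subgroups (abc-iut-L3-t6's `TemperedPiChart.isMaximalCompactSubgroup_of_nongenerating_open`,
by name), every verticial subgroup at `v` is a maximal compact subgroup — any countable `𝒢` under the hypotheses
of Thm 3.7, any edge groups, any underlying graph, every chart. [cite: MochizukiSemiAnbd2006, Thm 3.7(iv) p.41] -/
theorem isMaximalCompactSubgroup_of_mem_verticialSubgroups_of_finite_branches_or_nongenerating
    (h37 : 𝒢.Thm37Hypotheses) {v : 𝒢.graph.Vertex}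
    (hv : Set.Finite {b : 𝒢.graph.Branch | 𝒢.graph.abuts b = some v} ∨
      ∃ Φ : Subgroup (𝒢.Gv v), IsOpen (Φ : Set (𝒢.Gv v)) ∧
        ∀ A : Subgroup (𝒢.Gv v), IsClosed (A : Set (𝒢.Gv v)) → A ⊔ Φ = ⊤ → A = ⊤)
    (c : TemperedPiChart 𝒢) {H : Subgroup c.G} (hH : H ∈ verticialSubgroups c v) :
    IsMaximalCompactSubgroup H := by
  rcases hv with hfin | ⟨Φ, hΦo, hΦ⟩
  · exact isMaximalCompactSubgroup_of_mem_verticialSubgroups_of_finite_branches h37 hfin c hH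
  · exact TemperedPiChart.isMaximalCompactSubgroup_of_nongenerating_open h37 c Φ hΦo hΦ hH

/-- **The UNION class, whole graph**: if EVERY vertex of `𝒢` has finitely many branches or a vertex group with an
open non-generating subgroup (e.g. infinite valence only at vertices with topologically finitely generated pro-`p`
groups, as at the rayless star `𝒢⋆(p)`), then EVERY verticial subgroup of `π₁^temp(𝒢)` is a maximal compact
subgroup (every chart). [cite: MochizukiSemiAnbd2006, Thm 3.7(iv) p.41] -/
theorem isMaximalCompactSubgroup_of_mem_verticialSubgroups_of_forall_finite_branches_or_nongenerating
    (h37 : 𝒢.Thm37Hypotheses)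
    (hv : ∀ v : 𝒢.graph.Vertex, Set.Finite {b : 𝒢.graph.Branch | 𝒢.graph.abuts b = some v} ∨
      ∃ Φ : Subgroup (𝒢.Gv v), IsOpen (Φ : Set (𝒢.Gv v)) ∧
        ∀ A : Subgroup (𝒢.Gv v), IsClosed (A : Set (𝒢.Gv v)) → A ⊔ Φ = ⊤ → A = ⊤)
    (c : TemperedPiChart 𝒢) {v : 𝒢.graph.Vertex} {H : Subgroup c.G} (hH : H ∈ verticialSubgroups c v) :
    IsMaximalCompactSubgroup H :=
  isMaximalCompactSubgroup_of_mem_verticialSubgroups_of_finite_branches_or_nongenerating h37 (hv v) c hH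

/-- **No compact subgroup strictly contains a verticial subgroup** at a vertex of the union class (contrapositive
currency for the exotic-compact analysis: an exotic compact subgroup never contains such a verticial one).
[cite: MochizukiSemiAnbd2006, Thm 3.7(iv) p.41] -/
theorem eq_of_verticial_le_compact_of_finite_branches_or_nongenerating (h37 : 𝒢.Thm37Hypotheses)
    {v : 𝒢.graph.Vertex}
    (hv : Set.Finite {b : 𝒢.graph.Branch | 𝒢.graph.abuts b = some v} ∨
      ∃ Φ : Subgroup (𝒢.Gv v), IsOpen (Φ : Set (𝒢.Gv v)) ∧
        ∀ A : Subgroup (𝒢.Gv v), IsClosed (A : Set (𝒢.Gv v)) → A ⊔ Φ = ⊤ → A = ⊤)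
    (c : TemperedPiChart 𝒢) {H K : Subgroup c.G} (hH : H ∈ verticialSubgroups c v)
    (hKc : IsCompact (K : Set c.G)) (hHK : H ≤ K) : K = H :=
  (isMaximalCompactSubgroup_of_mem_verticialSubgroups_of_finite_branches_or_nongenerating h37 hv c hH).2 K hKc hHK

end ProfiniteSemiGraph

end Literature.AnabelianGeometry.SemiGraphs
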